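import Mathlib
import Summits.MatrixMultiplication.MatrixMultiplication.Theses.FourierTwoFamiliesModP
import Literature.Computability.AlgebraicComplexity.SimultaneousDoubleProduct
import Summits.MatrixMultiplication.MatrixMultiplication.Theorems.FourierTwoFamiliesModPPowerGainRefutes
import Summits.MatrixMultiplication.MatrixMultiplication.Theorems.FourierTwoFamiliesModPPrimeTwoFamiliesStubPackingTightOfCrux

/-!
# The single-scale kill criterion for `PrimeTwoFamilies`, balanced form (crux stmt-MatrixMultiplication-14308)

Item `stmt-MatrixMultiplication-14308` (`FourierTwoFamiliesModP.PrimeTwoFamilies`, CKSU 2005 Conj. 4.7 with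
prime cyclic hosts), line `Sketch`, registered stub `primeTwoFamilies_false_of_singleScaleDefect`
(siege k23, variation "reduce to landed lemmas of this crux, then assemble").

The stub says: a power defect `n ≤ p ^ (1 - γ/2 - c)` (`c > 0`) for ALL SDPP families of co-volume
`≥ p ^ γ` in all large prime cyclic groups, at ONE scale `γ ∈ (0,1)`, refutes the crux.  This file proves it
as a corollary of a strictly more convenient criterion, in the BALANCED vocabulary of the route's kill side
(`PrimeCyclicPowerGain`, `PrimeLogDecay`, `PrimeDensityDecay` all speak about `|A i| = |B i| = s`):

* `exists_balanced_subfamily` — BALANCING (Markov twice + shrinking, the mechanism of the route's kill link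
  `PowerGainRefutes`): an SDPP family of `n` pairs in a finite abelian group `H` with all co-volumes `≥ V > 0`
  contains, after reindexing and shrinking, a balanced SDPP family of `m ≥ n/2` pairs of `s`-sets with
  `V·n ≤ 4|H|·s` and `s·n ≤ 4|H|`;
* `primeTwoFamilies_false_of_balancedSingleScaleDefect` — BALANCED SINGLE-SCALE KILL CRITERION: if at one
  scale `γ ∈ (0,1)` there are `c > 0` and `p₀` such that every BALANCED SDPP family in `ZMod p`, `p ≥ p₀`
  prime, whose common block size `s` lies in the window `p ^ γ ≤ s² ≤ p ^ (γ + c)`, has `n ≤ p ^ (1 - γ/2 - c)`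
  pairs, then `PrimeTwoFamilies` fails.  Proof: the crux is packing-tight at the scale `γ + 3ε`
  (landed `CapacityLift.stub_packingTightOfCrux`, `ε = min (c/6) ((1-γ)/4)`); balance; the balanced family
  sits in the window and has `≥ p ^ (1-γ/2-5ε/2) / 2` pairs, against the defect `≤ p ^ (1-γ/2-c)`;
* `primeTwoFamilies_false_of_singleScaleDefect` — the registered stub, verbatim, by specialisation.

Sources: CKSU 2005 (arXiv:math/0511460) §4 (Def. 4.1, Prop. 4.6, Conj. 4.7); the bookkeeping is folklore.
Not here: any defect itself (that is the open kill side of the route).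
-/

-- single-conjunct summit: the mandated namespace repeats `MatrixMultiplication` (summit = sub-problem).
set_option linter.dupNamespace false

namespace Summit.MatrixMultiplication.MatrixMultiplication.Theorems.PrimeTwoFamilies.BalancedDefect

open Finset
open Summit.MatrixMultiplication.MatrixMultiplication.Theses
open Summit.MatrixMultiplication.MatrixMultiplication.Theorems
open Literature.Computability.AlgebraicComplexity

/-- **Balancing an SDPP family** (Markov twice, then shrink; the mechanism of the route's kill link
`PowerGainRefutes`).  If `(A i, B i)_{i<n}` is an SDPP family in a finite abelian group `H` with all
co-volumes `V ≤ |A i| |B i|`, `V > 0`, then there are `m`, `s` with `n ≤ 2m`, `V·n ≤ 4|H|·s`, `s·n ≤ 4|H|`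
and a BALANCED SDPP family `(A' j, B' j)_{j<m}` in `H` with `|A' j| = |B' j| = s`.  Indeed all sets are
non-empty, so the `A i` (resp. `B i`) are pairwise disjoint and `Σ|A i|, Σ|B i| ≤ |H|`; by Markov at least
`n/2` indices have `|A i|·n, |B i|·n ≤ 4|H|`, and there `|A i|, |B i| ≥ V·n/(4|H|)`; reindex these by `Fin m`
and shrink both sides to size `s = ⌈V·n/(4|H|)⌉₊`. [folklore] -/
theorem exists_balanced_subfamily {H : Type*} [AddCommGroup H] [Fintype H] {n : ℕ}
    {A B : Fin n → Finset H} (hS : IsSDPP A B) {V : ℝ} (hV : 0 < V)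
    (hcov : ∀ i : Fin n, V ≤ (((A i).card * (B i).card : ℕ) : ℝ)) :
    ∃ m s : ℕ, n ≤ 2 * m ∧ V * n ≤ 4 * (Fintype.card H : ℝ) * s ∧ s * n ≤ 4 * Fintype.card H ∧
      ∃ A' B' : Fin m → Finset H, IsSDPP A' B' ∧
        ∀ j : Fin m, (A' j).card = s ∧ (B' j).card = s := by
  classical
  set q : ℕ := Fintype.card H with hq_def
  have hq : 0 < q := Fintype.card_pos
  have hqR : (0 : ℝ) < q := by exact_mod_cast hq
  -- non-emptiness and the packings `Σ|Aᵢ| ≤ q`, `Σ|Bᵢ| ≤ q`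
  have hne : ∀ i : Fin n, (A i).Nonempty ∧ (B i).Nonempty := by
    intro i
    have h1 : 0 < (A i).card * (B i).card := by
      have : (0 : ℝ) < (((A i).card * (B i).card : ℕ) : ℝ) := hV.trans_le (hcov i)
      exact_mod_cast this
    refine ⟨Finset.card_pos.1 (Nat.pos_of_ne_zero fun h0 => ?_),
      Finset.card_pos.1 (Nat.pos_of_ne_zero fun h0 => ?_)⟩
    · rw [h0, zero_mul] at h1; exact lt_irrefl 0 h1
    · rw [h0, mul_zero] at h1; exact lt_irrefl 0 h1
  have hsumA : ∑ i, (A i).card ≤ q := hS.sum_card_left_le fun i => (hne i).2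
  have hsumB : ∑ i, (B i).card ≤ q := hS.sum_card_right_le fun i => (hne i).1
  -- the good indices
  set good := (Finset.univ : Finset (Fin n)).filter
    (fun i => (A i).card * n ≤ 4 * q ∧ (B i).card * n ≤ 4 * q) with hgood
  have hbadA := powerGainRefutes_four_mul_card_filter_le (fun i => (A i).card) hsumA
  have hbadB := powerGainRefutes_four_mul_card_filter_le (fun i => (B i).card) hsumB
  have hgood_card : n ≤ 2 * good.card := by
    -- complement of good ⊆ badA ∪ badB
    have hsub : (Finset.univ : Finset (Fin n)) ⊆ good ∪
        ((Finset.univ : Finset (Fin n)).filter (fun i => 4 * q < (A i).card * n) ∪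
         (Finset.univ : Finset (Fin n)).filter (fun i => 4 * q < (B i).card * n)) := by
      intro i _
      by_cases hA : (A i).card * n ≤ 4 * q
      · by_cases hB : (B i).card * n ≤ 4 * q
        · exact Finset.mem_union_left _ (Finset.mem_filter.2 ⟨Finset.mem_univ _, hA, hB⟩)
        · exact Finset.mem_union_right _ (Finset.mem_union_right _
            (Finset.mem_filter.2 ⟨Finset.mem_univ _, not_le.1 hB⟩))
      · exact Finset.mem_union_right _ (Finset.mem_union_left _
          (Finset.mem_filter.2 ⟨Finset.mem_univ _, not_le.1 hA⟩))
    have h1 := Finset.card_le_card hsub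
    rw [Finset.card_univ, Fintype.card_fin] at h1
    have h2 : (good ∪
        ((Finset.univ : Finset (Fin n)).filter (fun i => 4 * q < (A i).card * n) ∪
         (Finset.univ : Finset (Fin n)).filter (fun i => 4 * q < (B i).card * n))).card ≤
        good.card + (((Finset.univ : Finset (Fin n)).filter (fun i => 4 * q < (A i).card * n)).card +
          ((Finset.univ : Finset (Fin n)).filter (fun i => 4 * q < (B i).card * n)).card) :=
      (Finset.card_union_le _ _).trans (Nat.add_le_add_left (Finset.card_union_le _ _) _)
    have h3 := h1.trans h2
    omega
  -- the common block size
  set s : ℕ := ⌈V * n / (4 * q)⌉₊ with hs_def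
  have hs_low : V * n / (4 * q) ≤ s := Nat.le_ceil _
  have hVs : V * n ≤ 4 * (q : ℝ) * s := by
    have h1 := (div_le_iff₀ (by positivity : (0 : ℝ) < 4 * q)).1 hs_low
    linarith
  -- sizes on good indices: `|Aᵢ|, |Bᵢ| ≥ V n / (4 q)`
  have hkey : ∀ i ∈ good, s ≤ (A i).card ∧ s ≤ (B i).card := by
    intro i hi
    obtain ⟨-, hA4, hB4⟩ := Finset.mem_filter.1 hi
    have hA4r : ((A i).card : ℝ) * n ≤ 4 * q := by exact_mod_cast hA4
    have hB4r : ((B i).card : ℝ) * n ≤ 4 * q := by exact_mod_cast hB4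
    have hprod : V ≤ ((A i).card : ℝ) * ((B i).card : ℝ) := by
      have := hcov i; push_cast at this; exact this
    have hBlow : V * n / (4 * q) ≤ (B i).card := by
      rw [div_le_iff₀ (by positivity : (0 : ℝ) < 4 * q)]
      calc V * n ≤ ((A i).card : ℝ) * ((B i).card : ℝ) * n :=
            mul_le_mul_of_nonneg_right hprod (Nat.cast_nonneg _)
        _ = ((B i).card : ℝ) * (((A i).card : ℝ) * n) := by ring
        _ ≤ ((B i).card : ℝ) * (4 * q) := mul_le_mul_of_nonneg_left hA4r (Nat.cast_nonneg _)
    have hAlow : V * n / (4 * q) ≤ (A i).card := by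
      rw [div_le_iff₀ (by positivity : (0 : ℝ) < 4 * q)]
      calc V * n ≤ ((A i).card : ℝ) * ((B i).card : ℝ) * n :=
            mul_le_mul_of_nonneg_right hprod (Nat.cast_nonneg _)
        _ = ((A i).card : ℝ) * (((B i).card : ℝ) * n) := by ring
        _ ≤ ((A i).card : ℝ) * (4 * q) := mul_le_mul_of_nonneg_left hB4r (Nat.cast_nonneg _)
    exact ⟨Nat.ceil_le.2 hAlow, Nat.ceil_le.2 hBlow⟩
  -- `s · n ≤ 4 q`: through a good index if there is one, trivially if `n = 0`
  have hsn : s * n ≤ 4 * q := by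
    by_cases hg : good.Nonempty
    · obtain ⟨i, hi⟩ := hg
      obtain ⟨-, hA4, -⟩ := Finset.mem_filter.1 hi
      exact (Nat.mul_le_mul_right _ (hkey i hi).1).trans hA4
    · have h0 : good.card = 0 := Finset.card_eq_zero.2 (Finset.not_nonempty_iff_eq_empty.1 hg)
      have hn0 : n = 0 := by omega
      rw [hn0, mul_zero]; exact Nat.zero_le _
  -- reindex the good pairs by `Fin m` and shrink them to size `s`
  set m : ℕ := good.card with hm
  let ι : Fin m → Fin n := fun j => (good.equivFin.symm j).1
  have hιmem : ∀ j, ι j ∈ good := fun j => (good.equivFin.symm j).2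
  have hιinj : Function.Injective ι := by
    intro j j' h
    exact good.equivFin.symm.injective (Subtype.ext h)
  have hA' : ∀ j : Fin m, ∃ A' : Finset H, A' ⊆ A (ι j) ∧ A'.card = s :=
    fun j => Finset.exists_subset_card_eq (hkey _ (hιmem j)).1
  have hB' : ∀ j : Fin m, ∃ B' : Finset H, B' ⊆ B (ι j) ∧ B'.card = s :=
    fun j => Finset.exists_subset_card_eq (hkey _ (hιmem j)).2
  choose A' hA'sub hA'card using hA'
  choose B' hB'sub hB'card using hB'
  have hS' : IsSDPP A' B' := (hS.reindex ι hιinj).mono hA'sub hB'sub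
  exact ⟨m, s, hgood_card, hVs, hsn, A', B', hS', fun j => ⟨hA'card j, hB'card j⟩⟩

/-- **Balanced single-scale kill criterion.**  Let `0 < γ < 1` and `c > 0`.  Suppose that for all primes
`p ≥ p₀`, every BALANCED SDPP family `(A i, B i)_{i<n}` in `ZMod p` (clauses (W), (X); `|A i| = |B i| = s`)
whose block size lies in the scale window `p ^ γ ≤ s·s ≤ p ^ (γ + c)` has `n ≤ p ^ (1 - γ/2 - c)` pairs.
Then `PrimeTwoFamilies` (CKSU Conj. 4.7 with prime cyclic hosts) is false.  Proof: with
`ε = min (c/6) ((1-γ)/4)` the crux is packing-tight at scale `γ + 3ε < 1`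
(`CapacityLift.stub_packingTightOfCrux`): a prime `p ≥ max p₀ N`, `N ^ ε ≥ 16`, and an SDPP family with
co-volumes `≥ p ^ (γ+3ε)` and `n ≥ p ^ (1-γ/2-5ε/2)` pairs; balancing (`exists_balanced_subfamily`) gives
`m ≥ n/2` balanced pairs of size `s` with `p ^ (γ/2+ε/2) ≤ 4s` and `s ≤ 4 p ^ (γ/2+5ε/2)`, hence
`p ^ γ ≤ s² ≤ p ^ (γ+c)` (as `p ^ ε ≥ 16`, `6ε ≤ c`); the defect `m ≤ p ^ (1-γ/2-c)` then forces
`16 · p ^ (1-γ/2-c) ≤ p ^ (1-γ/2-5ε/2) ≤ n ≤ 2m ≤ 2 p ^ (1-γ/2-c)`, absurd. [folklore] -/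
theorem primeTwoFamilies_false_of_balancedSingleScaleDefect {γ c : ℝ} (hγ : 0 < γ) (hγ1 : γ < 1)
    (hc : 0 < c)
    (h : ∃ p₀ : ℕ, ∀ p : ℕ, p.Prime → p₀ ≤ p → ∀ (n s : ℕ) (A B : Fin n → Finset (ZMod p)),
      (∀ i : Fin n, (A i).card = s ∧ (B i).card = s) →
      (∀ i : Fin n, ∀ a ∈ A i, ∀ a' ∈ A i, ∀ b ∈ B i, ∀ b' ∈ B i,
          (a - a') + (b - b') = 0 → a = a' ∧ b = b') →
      (∀ i j k : Fin n, ∀ a ∈ A i, ∀ a' ∈ A j, ∀ b ∈ B j, ∀ b' ∈ B k,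
          (a - a') + (b - b') = 0 → i = k) →
      (p : ℝ) ^ γ ≤ ((s * s : ℕ) : ℝ) → ((s * s : ℕ) : ℝ) ≤ (p : ℝ) ^ (γ + c) →
      (n : ℝ) ≤ (p : ℝ) ^ (1 - γ / 2 - c)) :
    ¬ FourierTwoFamiliesModP.PrimeTwoFamilies := by
  intro hT
  obtain ⟨p₀, hp₀⟩ := h
  -- parameters
  set ε : ℝ := min (c / 6) ((1 - γ) / 4) with hε_def
  have hε : 0 < ε := lt_min (by linarith) (by linarith)
  have hεc : 6 * ε ≤ c := by
    have := min_le_left (c / 6) ((1 - γ) / 4); linarith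
  have hεγ : 4 * ε ≤ 1 - γ := by
    have := min_le_right (c / 6) ((1 - γ) / 4); linarith
  have hγ₁ : 0 < γ + 3 * ε := by linarith
  have hγ₁1 : γ + 3 * ε < 1 := by linarith
  -- the threshold `N ^ ε ≥ 16`
  set N : ℕ := ⌈(16 : ℝ) ^ (1 / ε)⌉₊ with hN_def
  obtain ⟨p, hp, hprime, n, A, B, hW, hX, hcov, hn⟩ :=
    CapacityLift.stub_packingTightOfCrux hT hγ₁ hγ₁1 ε hε (max p₀ N)
  have hp₀p : p₀ ≤ p := (le_max_left _ _).trans hp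
  have hNp : N ≤ p := (le_max_right _ _).trans hp
  have hp_pos : (0 : ℝ) < p := by exact_mod_cast hprime.pos
  have hp1 : (1 : ℝ) ≤ p := by exact_mod_cast hprime.one_lt.le
  have h16 : (16 : ℝ) ≤ (p : ℝ) ^ ε := by
    have h1 : (16 : ℝ) ^ (1 / ε) ≤ p := (Nat.le_ceil _).trans (by exact_mod_cast hNp)
    have h2 := Real.rpow_le_rpow (Real.rpow_nonneg (by norm_num) _) h1 hε.le
    rwa [one_div, Real.rpow_inv_rpow (by norm_num) hε.ne'] at h2
  haveI : Fact p.Prime := ⟨hprime⟩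
  have hS : IsSDPP A B := ⟨hW, hX⟩
  have hV : (0 : ℝ) < (p : ℝ) ^ (γ + 3 * ε) := Real.rpow_pos_of_pos hp_pos _
  obtain ⟨m, s, hnm, hVs, hsn, A', B', hS', hcard'⟩ := exists_balanced_subfamily hS hV hcov
  rw [ZMod.card] at hVs hsn
  -- the block size from below: `p ^ (γ/2 + ε/2) ≤ 4 s`
  have hs_low : (p : ℝ) ^ (γ / 2 + ε / 2) ≤ 4 * s := by
    have e1 : (p : ℝ) ^ (γ + 3 * ε) * (p : ℝ) ^ (1 - (γ + 3 * ε) / 2 - ε) =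
        (p : ℝ) * (p : ℝ) ^ (γ / 2 + ε / 2) := by
      rw [← Real.rpow_add hp_pos,
        show γ + 3 * ε + (1 - (γ + 3 * ε) / 2 - ε) = 1 + (γ / 2 + ε / 2) by ring,
        Real.rpow_add hp_pos, Real.rpow_one]
    have h1 : (p : ℝ) ^ (γ + 3 * ε) * (p : ℝ) ^ (1 - (γ + 3 * ε) / 2 - ε) ≤ 4 * (p : ℝ) * s :=
      (mul_le_mul_of_nonneg_left hn hV.le).trans hVs
    rw [e1] at h1
    have h2 : (p : ℝ) * (p : ℝ) ^ (γ / 2 + ε / 2) ≤ (p : ℝ) * (4 * s) := by linarith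
    exact le_of_mul_le_mul_left h2 hp_pos
  -- the block size from above: `s ≤ 4 p ^ (γ/2 + 5ε/2)`
  have hs_high : (s : ℝ) ≤ 4 * (p : ℝ) ^ (γ / 2 + 5 * ε / 2) := by
    have hsnR : (s : ℝ) * n ≤ 4 * p := by exact_mod_cast hsn
    have e1 : (p : ℝ) = (p : ℝ) ^ (γ / 2 + 5 * ε / 2) * (p : ℝ) ^ (1 - (γ + 3 * ε) / 2 - ε) := by
      rw [← Real.rpow_add hp_pos,
        show γ / 2 + 5 * ε / 2 + (1 - (γ + 3 * ε) / 2 - ε) = (1 : ℝ) by ring, Real.rpow_one]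
    have hpow : (0 : ℝ) < (p : ℝ) ^ (1 - (γ + 3 * ε) / 2 - ε) := Real.rpow_pos_of_pos hp_pos _
    have h1 : (s : ℝ) * (p : ℝ) ^ (1 - (γ + 3 * ε) / 2 - ε) ≤
        4 * (p : ℝ) ^ (γ / 2 + 5 * ε / 2) * (p : ℝ) ^ (1 - (γ + 3 * ε) / 2 - ε) := by
      calc (s : ℝ) * (p : ℝ) ^ (1 - (γ + 3 * ε) / 2 - ε) ≤ (s : ℝ) * n :=
            mul_le_mul_of_nonneg_left hn (Nat.cast_nonneg _)
        _ ≤ 4 * p := hsnR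
        _ = 4 * (p : ℝ) ^ (γ / 2 + 5 * ε / 2) * (p : ℝ) ^ (1 - (γ + 3 * ε) / 2 - ε) := by
            rw [mul_assoc, ← e1]
    exact le_of_mul_le_mul_right h1 hpow
  -- the scale window `p ^ γ ≤ s·s ≤ p ^ (γ + c)`
  have hwin_low : (p : ℝ) ^ γ ≤ ((s * s : ℕ) : ℝ) := by
    push_cast
    have h0 : (0 : ℝ) ≤ (p : ℝ) ^ (γ / 2 + ε / 2) := Real.rpow_nonneg hp_pos.le _
    have h1 : (p : ℝ) ^ (γ / 2 + ε / 2) * (p : ℝ) ^ (γ / 2 + ε / 2) ≤ (4 * s) * (4 * s) :=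
      mul_self_le_mul_self h0 hs_low
    have e1 : (p : ℝ) ^ (γ / 2 + ε / 2) * (p : ℝ) ^ (γ / 2 + ε / 2) = (p : ℝ) ^ γ * (p : ℝ) ^ ε := by
      rw [← Real.rpow_add hp_pos, ← Real.rpow_add hp_pos]
      congr 1; ring
    rw [e1] at h1
    have hγpos : (0 : ℝ) ≤ (p : ℝ) ^ γ := Real.rpow_nonneg hp_pos.le _
    have h2 : (p : ℝ) ^ γ * 16 ≤ (p : ℝ) ^ γ * (p : ℝ) ^ ε := mul_le_mul_of_nonneg_left h16 hγpos
    nlinarith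
  have hwin_high : ((s * s : ℕ) : ℝ) ≤ (p : ℝ) ^ (γ + c) := by
    push_cast
    have hs0 : (0 : ℝ) ≤ s := Nat.cast_nonneg _
    have h1 : (s : ℝ) * s ≤ (4 * (p : ℝ) ^ (γ / 2 + 5 * ε / 2)) * (4 * (p : ℝ) ^ (γ / 2 + 5 * ε / 2)) :=
      mul_self_le_mul_self hs0 hs_high
    have e1 : (4 * (p : ℝ) ^ (γ / 2 + 5 * ε / 2)) * (4 * (p : ℝ) ^ (γ / 2 + 5 * ε / 2)) =
        16 * (p : ℝ) ^ (γ + 5 * ε) := by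
      rw [show (16 : ℝ) * (p : ℝ) ^ (γ + 5 * ε) = 4 * 4 * ((p : ℝ) ^ (γ / 2 + 5 * ε / 2) *
          (p : ℝ) ^ (γ / 2 + 5 * ε / 2)) by
        rw [← Real.rpow_add hp_pos]; ring_nf]
      ring
    rw [e1] at h1
    -- `16 p ^ (γ+5ε) ≤ p ^ ε · p ^ (γ+5ε) = p ^ (γ+6ε) ≤ p ^ (γ+c)`
    have h5pos : (0 : ℝ) ≤ (p : ℝ) ^ (γ + 5 * ε) := Real.rpow_nonneg hp_pos.le _
    have h2 : 16 * (p : ℝ) ^ (γ + 5 * ε) ≤ (p : ℝ) ^ ε * (p : ℝ) ^ (γ + 5 * ε) :=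
      mul_le_mul_of_nonneg_right h16 h5pos
    have e2 : (p : ℝ) ^ ε * (p : ℝ) ^ (γ + 5 * ε) = (p : ℝ) ^ (γ + 6 * ε) := by
      rw [← Real.rpow_add hp_pos]; congr 1; ring
    have h3 : (p : ℝ) ^ (γ + 6 * ε) ≤ (p : ℝ) ^ (γ + c) :=
      Real.rpow_le_rpow_of_exponent_le hp1 (by linarith)
    linarith
  -- the defect on the balanced family
  have hdef := hp₀ p hprime hp₀p m s A' B' hcard' hS'.1 hS'.2 hwin_low hwin_high
  -- count: `16 · p ^ (1-γ/2-c) ≤ p ^ (1-γ/2-5ε/2) ≤ n ≤ 2 m ≤ 2 p ^ (1-γ/2-c)`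
  have hnmR : (n : ℝ) ≤ 2 * m := by exact_mod_cast hnm
  have hXpos : (0 : ℝ) < (p : ℝ) ^ (1 - γ / 2 - c) := Real.rpow_pos_of_pos hp_pos _
  have e1 : (p : ℝ) ^ (1 - (γ + 3 * ε) / 2 - ε) = (p : ℝ) ^ (1 - γ / 2 - c) * (p : ℝ) ^ (c - 5 * ε / 2) := by
    rw [← Real.rpow_add hp_pos]; congr 1; ring
  have hY : (16 : ℝ) ≤ (p : ℝ) ^ (c - 5 * ε / 2) :=
    h16.trans (Real.rpow_le_rpow_of_exponent_le hp1 (by linarith))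
  have h1 : (p : ℝ) ^ (1 - γ / 2 - c) * 16 ≤ (p : ℝ) ^ (1 - γ / 2 - c) * (p : ℝ) ^ (c - 5 * ε / 2) :=
    mul_le_mul_of_nonneg_left hY hXpos.le
  rw [← e1] at h1
  linarith

/-- **SINGLE-SCALE KILL CRITERION** (registered stub `primeTwoFamilies_false_of_singleScaleDefect` of line
`Sketch`, verbatim).  If at ONE scale `γ ∈ (0,1)` there is a power defect `c > 0` — for all primes `p ≥ p₀`,
every SDPP family in `ZMod p` with all co-volumes `≥ p ^ γ` has `n ≤ p ^ (1 - γ/2 - c)` pairs — then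
`PrimeTwoFamilies` is false.  By specialisation of `primeTwoFamilies_false_of_balancedSingleScaleDefect` to
the families the balanced criterion quantifies over (a balanced family with `p ^ γ ≤ s·s` has all
co-volumes `|A i| |B i| = s·s ≥ p ^ γ`).  Generalises the route's kill link `PowerGainRefutes` (a defect at
all scales simultaneously) to the single most convenient scale. [folklore] -/
theorem primeTwoFamilies_false_of_singleScaleDefect {γ c : ℝ} (hγ : 0 < γ) (hγ1 : γ < 1) (hc : 0 < c)
    (h : ∃ p₀ : ℕ, ∀ p : ℕ, p.Prime → p₀ ≤ p → ∀ (n : ℕ) (A B : Fin n → Finset (ZMod p)),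
      (∀ i : Fin n, ∀ a ∈ A i, ∀ a' ∈ A i, ∀ b ∈ B i, ∀ b' ∈ B i,
          (a - a') + (b - b') = 0 → a = a' ∧ b = b') →
      (∀ i j k : Fin n, ∀ a ∈ A i, ∀ a' ∈ A j, ∀ b ∈ B j, ∀ b' ∈ B k,
          (a - a') + (b - b') = 0 → i = k) →
      (∀ i : Fin n, (p : ℝ) ^ γ ≤ (((A i).card * (B i).card : ℕ) : ℝ)) →
      (n : ℝ) ≤ (p : ℝ) ^ (1 - γ / 2 - c)) :
    ¬ FourierTwoFamiliesModP.PrimeTwoFamilies := by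
  obtain ⟨p₀, hp₀⟩ := h
  refine primeTwoFamilies_false_of_balancedSingleScaleDefect hγ hγ1 hc ⟨p₀, ?_⟩
  intro p hp hp₀p n s A B hcard hW hX hlow _
  refine hp₀ p hp hp₀p n A B hW hX fun i => ?_
  rw [(hcard i).1, (hcard i).2]
  exact hlow

end Summit.MatrixMultiplication.MatrixMultiplication.Theorems.PrimeTwoFamilies.BalancedDefect
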